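import Mathlib
import Summits.Ventures.PercRepro2.Defs
import Summits.Ventures.PercRepro2.Independence
import Summits.Ventures.PercRepro2.Harris
import Summits.Ventures.PercRepro2.Graph
import Summits.Ventures.PercRepro2.Events
import Summits.Ventures.PercRepro2.BasePendant
import Summits.Ventures.PercRepro2.CDQuasiConcave

/-!
# Row 2′CD across a pendant second root: the mixture cubic and the reduction
(blind cell PercRepro2, mine-a g37; MINE-A.md §92)

Let the second root `a₂` be a LEAF, with its unique edge `g = {a₂, u}` of weight `t = p g`.
Revealing `g` first (the lens' first move), the `Q`-world of `G` is the `(1 − t)/t` mixture of the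
world with `g` closed (`a₂` isolated: `Q` sure, `f = {a₂ ↔ o}` empty, `N = {a₃ ∉ C₁}`,
`oU = {o ∈ C₁}`) and the world with `g` open (`a₂` glued to `u`: every event of the row at
`(a₁, a₂, a₃, o)` is the same event of the row at `(a₁, u, a₃, o)`).  By the pinning identity
`P_p(A) = t·P_{p[g↦1]}(A) + (1 − t)·P_{p[g↦0]}(A)` every one of the eight masses is affine in `t`,
and the cleared row `cdCleared p` is the CUBIC

  `cdCleared p = (1−t)³·K₃ + (1−t)²t·c₂ + (1−t)t²·c₁ + t³·K₀`,

`K₃ = P₀(eᶜ ∩ L)·Cov₀(U, e) ≥ 0` (Harris in the closed world), `K₀ = cdCleared p[g↦1]` at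
`(a₁, u, a₃, o)` (the `u`-row), and `c₂`, `c₁` the two middle Bernstein coefficients — explicit
polynomials in the masses of the two worlds: with `P₀ = P_{p[g↦0]}`, `P₁ = P_{p[g↦1]}`,
`u₀ = P₀(U)`, `b₀ = P₀(Ue)`, `d₀ = P₀(e)`, `n₀ = P₀(eᶜ)`, `m₀ = P₀(eᶜ ∩ L)` (`L = {o ∈ C₁}`),
`q₁ = P₁(Q_u)`, `u₁ = P₁(Q_u U)`, `a₁ = P₁(Q_u U e f_u)`, `b₁ = P₁(Q_u U e)`, `c₁ = P₁(Q_u e f_u)`,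
`d₁ = P₁(Q_u e)`, `n₁ = P₁(Q_u N_u)`, `m₁ = P₁(Q_u N_u oU_u)` (`Q_u = {a₁ ↮ u}`, `f_u = {u ↔ o}`,
`N_u = {a₃ ∉ C₁ ∪ C_u}`, `oU_u = {o ∈ C₁ ∪ C_u}`):
`c₂ = m₀·Y + m₁·B₀ − n₀·X`, `c₁ = m₀·B₁ + m₁·Y − n₀·A₁ − n₁·X`, where `B₀ = b₀ − u₀d₀`,
`X = a₁ − u₀c₁`, `Y = b₁ + q₁b₀ − u₀d₁ − u₁d₀`, `B₁ = q₁b₁ − u₁d₁`, `A₁ = q₁a₁ − u₁c₁`.  THEOREM (`cd_of_leaf_a₂_of_coeffs`):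
if the `u`-row holds under `p[g↦1]` and `c₂, c₁ ≥ 0` (the hypotheses `hc₂`, `hc₁`, written out), then row 2′CD holds at `(a₁, a₂, a₃, o)`
under `p` — the row TRANSFERS ACROSS A PENDANT `a₂` (what the `a₃`-required anti-correlation does
not do, MINE-A.md §91.8).  The hypotheses `c₂ ≥ 0`, `c₁ ≥ 0` are cross-world statements about the
graph without `a₂` (census: 1,693,440 exact tests on all graphs on 5 vertices, 0 failures); they
are NOT proved here.  No definition; no new axiom.
-/

namespace Summit.Ventures.PercRepro2

namespace CDPendantMix

section Congr

variable {E : Type*} [Fintype E] [DecidableEq E] {R : Type*} [Field R]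

/-- Two events that agree on the configurations with `g` OPEN have the same probability under
`p[g↦1]`. -/
lemma prob_update_one_congr (p : E → R) (g : E) {A B : Set (Config E)}
    (h : ∀ ω : Config E, ω g = true → (ω ∈ A ↔ ω ∈ B)) :
    prob (Function.update p g 1) A = prob (Function.update p g 1) B := by
  rw [← prob_update_one_inter_openEdge p A g, ← prob_update_one_inter_openEdge p B g]
  congr 1
  ext ω
  simp only [Set.mem_inter_iff, openEdge, Set.mem_setOf_eq]
  exact and_congr_left (h ω)

/-- Two events that agree on the configurations with `g` CLOSED have the same probability under
`p[g↦0]`. -/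
lemma prob_update_zero_congr_closed (p : E → R) (g : E) {A B : Set (Config E)}
    (h : ∀ ω : Config E, ω g = false → (ω ∈ A ↔ ω ∈ B)) :
    prob (Function.update p g 0) A = prob (Function.update p g 0) B := by
  rw [← prob_update_zero_inter_closedEdge p A g, ← prob_update_zero_inter_closedEdge p B g]
  congr 1
  ext ω
  simp only [Set.mem_inter_iff, closedEdge, Set.mem_setOf_eq]
  exact and_congr_left (h ω)

end Congr


section Main

variable {V : Type*} {E : Type*} [Fintype E] [DecidableEq E] [Fintype V] [DecidableEq V]
  {R : Type*} [Field R] [LinearOrder R] [IsStrictOrderedRing R]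

omit [Fintype V] [DecidableEq V] in
set_option maxHeartbeats 1000000 in
/-- **Row 2′CD transfers across a pendant `a₂` modulo the two middle Bernstein coefficients.**
Let `a₂` be a leaf with its unique edge `g = {a₂, u}`, and `a₁, a₃, o ≠ a₂`.  If row 2′CD holds at
`(a₁, u, a₃, o)` under `p[g↦1]` (the `u`-row) and the two middle Bernstein coefficients `c₂`, `c₁`
(module docstring) are nonnegative, then row 2′CD holds at `(a₁, a₂, a₃, o)` under `p`:

  `cdCleared p = (1−t)³·P₀(eᶜ ∩ L)·Cov₀(U, e) + (1−t)²t·c₂ + (1−t)t²·c₁ + t³·(u-row)`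

with every term `≥ 0` (Harris in the closed world for the first). -/
theorem cd_of_leaf_a₂_of_coeffs (p : E → R) (hp : IsProbVec p) (ends : E → Sym2 V)
    (a₁ a₂ a₃ o u : V) {g : E} (hg : ends g = s(a₂, u)) (hleaf : ∀ e, a₂ ∈ ends e → e = g)
    (h2u : a₂ ≠ u) (h12 : a₁ ≠ a₂) (h32 : a₃ ≠ a₂) (ho2 : o ≠ a₂) {𝓔 : Set (Set V)}
    (h𝓔 : IsUpperSet 𝓔)
    (hrow : 0 ≤ CDQC.cdCleared (Function.update p g 1) ends a₁ u a₃ o 𝓔)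
    (hc₂ : 0 ≤
      prob (Function.update p g 0) ((connEvent ends a₁ a₃)ᶜ ∩ connEvent ends a₁ o) *
          (prob (Function.update p g 1) ((connEvent ends a₁ u)ᶜ ∩ clusterInEvent ends a₁ 𝓔 ∩
              connEvent ends a₁ a₃) +
            prob (Function.update p g 1) (connEvent ends a₁ u)ᶜ *
              prob (Function.update p g 0) (clusterInEvent ends a₁ 𝓔 ∩ connEvent ends a₁ a₃) -
            prob (Function.update p g 0) (clusterInEvent ends a₁ 𝓔) *
              prob (Function.update p g 1) ((connEvent ends a₁ u)ᶜ ∩ connEvent ends a₁ a₃) -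
            prob (Function.update p g 1) ((connEvent ends a₁ u)ᶜ ∩ clusterInEvent ends a₁ 𝓔) *
              prob (Function.update p g 0) (connEvent ends a₁ a₃)) +
        prob (Function.update p g 1) ((connEvent ends a₁ u)ᶜ ∩
            ((connEvent ends a₁ a₃)ᶜ ∩ (connEvent ends u a₃)ᶜ) ∩
            (connEvent ends a₁ o ∪ connEvent ends u o)) *
          (prob (Function.update p g 0) (clusterInEvent ends a₁ 𝓔 ∩ connEvent ends a₁ a₃) -
            prob (Function.update p g 0) (clusterInEvent ends a₁ 𝓔) *
              prob (Function.update p g 0) (connEvent ends a₁ a₃)) -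
        prob (Function.update p g 0) (connEvent ends a₁ a₃)ᶜ *
          (prob (Function.update p g 1) ((connEvent ends a₁ u)ᶜ ∩ clusterInEvent ends a₁ 𝓔 ∩
              connEvent ends a₁ a₃ ∩ connEvent ends u o) -
            prob (Function.update p g 0) (clusterInEvent ends a₁ 𝓔) *
              prob (Function.update p g 1) ((connEvent ends a₁ u)ᶜ ∩ connEvent ends a₁ a₃ ∩
                connEvent ends u o)))
    (hc₁ : 0 ≤
      prob (Function.update p g 0) ((connEvent ends a₁ a₃)ᶜ ∩ connEvent ends a₁ o) *
          (prob (Function.update p g 1) (connEvent ends a₁ u)ᶜ *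
              prob (Function.update p g 1) ((connEvent ends a₁ u)ᶜ ∩ clusterInEvent ends a₁ 𝓔 ∩
                connEvent ends a₁ a₃) -
            prob (Function.update p g 1) ((connEvent ends a₁ u)ᶜ ∩ clusterInEvent ends a₁ 𝓔) *
              prob (Function.update p g 1) ((connEvent ends a₁ u)ᶜ ∩ connEvent ends a₁ a₃)) +
        prob (Function.update p g 1) ((connEvent ends a₁ u)ᶜ ∩
            ((connEvent ends a₁ a₃)ᶜ ∩ (connEvent ends u a₃)ᶜ) ∩
            (connEvent ends a₁ o ∪ connEvent ends u o)) *
          (prob (Function.update p g 1) ((connEvent ends a₁ u)ᶜ ∩ clusterInEvent ends a₁ 𝓔 ∩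
              connEvent ends a₁ a₃) +
            prob (Function.update p g 1) (connEvent ends a₁ u)ᶜ *
              prob (Function.update p g 0) (clusterInEvent ends a₁ 𝓔 ∩ connEvent ends a₁ a₃) -
            prob (Function.update p g 0) (clusterInEvent ends a₁ 𝓔) *
              prob (Function.update p g 1) ((connEvent ends a₁ u)ᶜ ∩ connEvent ends a₁ a₃) -
            prob (Function.update p g 1) ((connEvent ends a₁ u)ᶜ ∩ clusterInEvent ends a₁ 𝓔) *
              prob (Function.update p g 0) (connEvent ends a₁ a₃)) -
        prob (Function.update p g 0) (connEvent ends a₁ a₃)ᶜ *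
          (prob (Function.update p g 1) (connEvent ends a₁ u)ᶜ *
              prob (Function.update p g 1) ((connEvent ends a₁ u)ᶜ ∩ clusterInEvent ends a₁ 𝓔 ∩
                connEvent ends a₁ a₃ ∩ connEvent ends u o) -
            prob (Function.update p g 1) ((connEvent ends a₁ u)ᶜ ∩ clusterInEvent ends a₁ 𝓔) *
              prob (Function.update p g 1) ((connEvent ends a₁ u)ᶜ ∩ connEvent ends a₁ a₃ ∩
                connEvent ends u o)) -
        prob (Function.update p g 1) ((connEvent ends a₁ u)ᶜ ∩
            ((connEvent ends a₁ a₃)ᶜ ∩ (connEvent ends u a₃)ᶜ)) *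
          (prob (Function.update p g 1) ((connEvent ends a₁ u)ᶜ ∩ clusterInEvent ends a₁ 𝓔 ∩
              connEvent ends a₁ a₃ ∩ connEvent ends u o) -
            prob (Function.update p g 0) (clusterInEvent ends a₁ 𝓔) *
              prob (Function.update p g 1) ((connEvent ends a₁ u)ᶜ ∩ connEvent ends a₁ a₃ ∩
                connEvent ends u o))) :
    0 ≤ CDQC.cdCleared p ends a₁ a₂ a₃ o 𝓔 := by
  classical
  -- expose the masses of the hypotheses before naming the events
  unfold CDQC.cdCleared at hrow
  simp only at hrow
  set p₀ := Function.update p g 0 with hp₀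
  set p₁ := Function.update p g 1 with hp₁
  have hp0 : IsProbVec p₀ := hp.update g le_rfl zero_le_one
  set t := p g with ht
  have ht0 : 0 ≤ t := hp.nonneg g
  have ht1 : t ≤ 1 := hp.le_one g
  -- the events of the row at `(a₁, a₂, a₃, o)`
  set Q := (connEvent ends a₁ a₂)ᶜ with hQ
  set UG := clusterInEvent ends a₁ 𝓔 with hUG
  set eG := connEvent ends a₁ a₃ with heG
  set LG := connEvent ends a₁ o with hLG
  set fE := connEvent ends a₂ o with hfE
  set N := (connEvent ends a₁ a₃)ᶜ ∩ (connEvent ends a₂ a₃)ᶜ with hN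
  set oU := connEvent ends a₁ o ∪ connEvent ends a₂ o with hoU
  -- the events of the row at `(a₁, u, a₃, o)`
  set Qu := (connEvent ends a₁ u)ᶜ with hQu
  set fu := connEvent ends u o with hfu
  set Nu := (connEvent ends a₁ a₃)ᶜ ∩ (connEvent ends u a₃)ᶜ with hNu
  set oUu := connEvent ends a₁ o ∪ connEvent ends u o with hoUu
  -- pointwise facts with `g` open: `a₂` is glued to `u`
  have c12 : ∀ ω : Config E, ω g = true → (Conn ends ω a₁ a₂ ↔ Conn ends ω a₁ u) := by
    intro ω hω
    constructor
    · intro h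
      exact conn_symm ((conn_leaf_open hg hω).mp (conn_symm h))
    · intro h
      exact conn_symm ((conn_leaf_open hg hω).mpr (conn_symm h))
  have c2o : ∀ ω : Config E, ω g = true → (Conn ends ω a₂ o ↔ Conn ends ω u o) :=
    fun ω hω => conn_leaf_open hg hω
  have c23 : ∀ ω : Config E, ω g = true → (Conn ends ω a₂ a₃ ↔ Conn ends ω u a₃) :=
    fun ω hω => conn_leaf_open hg hω
  -- pointwise facts with `g` closed: `a₂` is isolated
  have z12 : ∀ ω : Config E, ω g = false → ¬ Conn ends ω a₁ a₂ := fun ω hω h =>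
    h12 (conn_leaf_closed hg hleaf h2u hω (conn_symm h))
  have z2o : ∀ ω : Config E, ω g = false → ¬ Conn ends ω a₂ o := fun ω hω h =>
    ho2 (conn_leaf_closed hg hleaf h2u hω h)
  have z23 : ∀ ω : Config E, ω g = false → ¬ Conn ends ω a₂ a₃ := fun ω hω h =>
    h32 (conn_leaf_closed hg hleaf h2u hω h)
  have split : ∀ A : Set (Config E), prob p A = t * prob p₁ A + (1 - t) * prob p₀ A :=
    fun A => prob_eq_pin p A g
  -- the open world: the eight masses are those of the `u`-row
  have T1 : prob p₁ (Q ∩ N ∩ oU) = prob p₁ (Qu ∩ Nu ∩ oUu) := by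
    refine prob_update_one_congr p g fun ω hω => ?_
    simp only [hQ, hN, hoU, hQu, hNu, hoUu, Set.mem_inter_iff, Set.mem_compl_iff, Set.mem_union,
      mem_connEvent, c12 ω hω, c23 ω hω, c2o ω hω]
  have T2 : prob p₁ (Q ∩ N) = prob p₁ (Qu ∩ Nu) := by
    refine prob_update_one_congr p g fun ω hω => ?_
    simp only [hQ, hN, hQu, hNu, Set.mem_inter_iff, Set.mem_compl_iff, mem_connEvent, c12 ω hω,
      c23 ω hω]
  have T3 : prob p₁ Q = prob p₁ Qu := by
    refine prob_update_one_congr p g fun ω hω => ?_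
    simp only [hQ, hQu, Set.mem_compl_iff, mem_connEvent, c12 ω hω]
  have T4 : prob p₁ (Q ∩ UG ∩ eG) = prob p₁ (Qu ∩ UG ∩ eG) := by
    refine prob_update_one_congr p g fun ω hω => ?_
    simp only [hQ, hQu, Set.mem_inter_iff, Set.mem_compl_iff, mem_connEvent, c12 ω hω]
  have T5 : prob p₁ (Q ∩ UG) = prob p₁ (Qu ∩ UG) := by
    refine prob_update_one_congr p g fun ω hω => ?_
    simp only [hQ, hQu, Set.mem_inter_iff, Set.mem_compl_iff, mem_connEvent, c12 ω hω]
  have T6 : prob p₁ (Q ∩ eG) = prob p₁ (Qu ∩ eG) := by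
    refine prob_update_one_congr p g fun ω hω => ?_
    simp only [hQ, hQu, Set.mem_inter_iff, Set.mem_compl_iff, mem_connEvent, c12 ω hω]
  have T7 : prob p₁ (Q ∩ UG ∩ eG ∩ fE) = prob p₁ (Qu ∩ UG ∩ eG ∩ fu) := by
    refine prob_update_one_congr p g fun ω hω => ?_
    simp only [hQ, hQu, hfE, hfu, Set.mem_inter_iff, Set.mem_compl_iff, mem_connEvent, c12 ω hω,
      c2o ω hω]
  have T8 : prob p₁ (Q ∩ eG ∩ fE) = prob p₁ (Qu ∩ eG ∩ fu) := by
    refine prob_update_one_congr p g fun ω hω => ?_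
    simp only [hQ, hQu, hfE, hfu, Set.mem_inter_iff, Set.mem_compl_iff, mem_connEvent, c12 ω hω,
      c2o ω hω]
  -- the closed world: `Q` sure, `f` empty, `N = eᶜ`, `oU = L`
  have C1 : prob p₀ (Q ∩ N ∩ oU) = prob p₀ (eGᶜ ∩ LG) := by
    refine prob_update_zero_congr_closed p g fun ω hω => ?_
    simp only [hQ, hN, hoU, heG, hLG, Set.mem_inter_iff, Set.mem_compl_iff, Set.mem_union,
      mem_connEvent, z12 ω hω, z2o ω hω, z23 ω hω, not_false_eq_true, true_and, and_true, or_false]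
  have C2 : prob p₀ (Q ∩ N) = prob p₀ eGᶜ := by
    refine prob_update_zero_congr_closed p g fun ω hω => ?_
    simp only [hQ, hN, heG, Set.mem_inter_iff, Set.mem_compl_iff, mem_connEvent, z12 ω hω,
      z23 ω hω, not_false_eq_true, true_and, and_true]
  have C3 : prob p₀ Q = 1 := by
    rw [show prob p₀ Q = prob p₀ Set.univ from prob_update_zero_congr_closed p g fun ω hω => by
      simp only [hQ, Set.mem_compl_iff, mem_connEvent, z12 ω hω, not_false_eq_true, Set.mem_univ]]
    exact prob_univ p₀
  have C4 : prob p₀ (Q ∩ UG ∩ eG) = prob p₀ (UG ∩ eG) := by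
    refine prob_update_zero_congr_closed p g fun ω hω => ?_
    simp only [hQ, Set.mem_inter_iff, Set.mem_compl_iff, mem_connEvent, z12 ω hω,
      not_false_eq_true, true_and]
  have C5 : prob p₀ (Q ∩ UG) = prob p₀ UG := by
    refine prob_update_zero_congr_closed p g fun ω hω => ?_
    simp only [hQ, Set.mem_inter_iff, Set.mem_compl_iff, mem_connEvent, z12 ω hω,
      not_false_eq_true, true_and]
  have C6 : prob p₀ (Q ∩ eG) = prob p₀ eG := by
    refine prob_update_zero_congr_closed p g fun ω hω => ?_
    simp only [hQ, Set.mem_inter_iff, Set.mem_compl_iff, mem_connEvent, z12 ω hω,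
      not_false_eq_true, true_and]
  have C7 : prob p₀ (Q ∩ UG ∩ eG ∩ fE) = 0 := by
    rw [show prob p₀ (Q ∩ UG ∩ eG ∩ fE) = prob p₀ ∅ from
      prob_update_zero_congr_closed p g fun ω hω => by
        simp only [hfE, Set.mem_inter_iff, mem_connEvent, z2o ω hω, and_false,
          Set.mem_empty_iff_false]]
    exact prob_empty p₀
  have C8 : prob p₀ (Q ∩ eG ∩ fE) = 0 := by
    rw [show prob p₀ (Q ∩ eG ∩ fE) = prob p₀ ∅ from
      prob_update_zero_congr_closed p g fun ω hω => by
        simp only [hfE, Set.mem_inter_iff, mem_connEvent, z2o ω hω, and_false,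
          Set.mem_empty_iff_false]]
    exact prob_empty p₀
  -- Harris in the closed world: `K₃ ≥ 0`
  have hHarris : prob p₀ UG * prob p₀ eG ≤ prob p₀ (UG ∩ eG) :=
    prob_mul_prob_le_prob_inter hp0 (isUpperSet_clusterInEvent ends a₁ h𝓔)
      (isUpperSet_connEvent ends a₁ a₃)
  have hm0 : 0 ≤ prob p₀ (eGᶜ ∩ LG) := prob_nonneg hp0 _
  have hK3 : 0 ≤ prob p₀ (eGᶜ ∩ LG) * (prob p₀ (UG ∩ eG) - prob p₀ UG * prob p₀ eG) :=
    mul_nonneg hm0 (by linarith)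
  -- the cubic
  unfold CDQC.cdCleared
  simp only
  rw [split (Q ∩ N ∩ oU), split (Q ∩ N), split Q, split (Q ∩ UG ∩ eG), split (Q ∩ UG),
    split (Q ∩ eG), split (Q ∩ UG ∩ eG ∩ fE), split (Q ∩ eG ∩ fE),
    T1, T2, T3, T4, T5, T6, T7, T8, C1, C2, C3, C4, C5, C6, C7, C8]
  have hq := add_nonneg (add_nonneg (add_nonneg
    (mul_nonneg (pow_nonneg (sub_nonneg.mpr ht1) 3) hK3)
    (mul_nonneg (mul_nonneg (pow_nonneg (sub_nonneg.mpr ht1) 2) ht0) hc₂))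
    (mul_nonneg (mul_nonneg (sub_nonneg.mpr ht1) (pow_nonneg ht0 2)) hc₁))
    (mul_nonneg (pow_nonneg ht0 3) hrow)
  linear_combination hq

end Main

end CDPendantMix

end Summit.Ventures.PercRepro2
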